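import Mathlib
import Literature.Computability.Complexity.CircuitClasses
import Literature.Computability.Complexity.ConstantDepth
import Literature.Computability.Complexity.FormulaComposition
import Literature.Computability.Complexity.Promise
import Literature.Computability.MetaComplexity.FormulaModelsAE
import HarnessLib

/-!
# Parity-at-the-bottom models, almost everywhere: `AC⁰-XOR[s]` (`ACdXORae`), `Formula-XOR[s]`
# (`FORMULAXORae`) and `γ`-almost-formulas (`AlmostFORMULAae`)

Vocabulary file (definitions + folklore API, no named facts) for the hardness-magnification census
rows over the hybrid models of Chen–Hirahara–Oliveira–Pich–Rajgopal–Santhanam, *Beyond natural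
proofs: hardness magnification and locality* (ITCS 2020 / J. ACM 69(4) 2022, arXiv:1911.08297), §1.1
frontiers A, B, C and §3.1, and of Oliveira–Pich–Santhanam, *Hardness magnification near
state-of-the-art lower bounds* (Theory of Computing 17(11), 2021), Thm. 1.1 item 2. It follows the
almost-everywhere convention of `FormulaModelsAE` (`FamilyAE P`: the structural and size constraints
bind for all sufficiently large input lengths, the family decides the language at every length).

## The printed models (verbatim)

* CHOPRS, §1.1, note A (p. 3): *"The AC⁰-XOR model is the extension of AC⁰ where gates at the bottom
  layer of the circuit can compute arbitrary parity functions. AC⁰-XOR[s] denotes AC⁰-XOR circuits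
  of size s where the size is measured as the number of gates."*
* CHOPRS, §1.1, note B (p. 4): *"Formula-XOR[s] refers to the class of Boolean formulas over the De
  Morgan basis with at most s leaves, where each leaf is an XOR of arbitrary arity over the inputs"*
  (footnote: *"Note that Formula-XOR[N^{1.01}] ⊆ Formula[N^{3.01}]."*).
* OPS 2021, §1.1 "Notation" (p. 4): *"extended U₂-formulas where the input leaves are labelled by
  literals, constants, or parity functions over the input bits of arbitrary arity. The corresponding
  classes of formulas of size at most s (measured by the number of leaves) will be denoted by …
  U₂-Formula-⊕[s]"*.
* CHOPRS, §1.1, note C (p. 4): *"An almost-formula is a circuit with a bounded number of gates of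
  fan-out larger than 1. More precisely, a γ-Almost-Formula[s] is a circuit containing at most s
  AND, OR, NOT gates of fan-in at most 2, and among such gates, at most γ of them have fan-out larger
  than 1."*

## Rendering over `Complexity.Circuit`

A parity leaf / bottom parity gate is a gate whose gate function is `GateFn.xor k` (`parityGates =
Set.range GateFn.xor`) and whose argument wires are all INPUT VARIABLES (`Circuit.XorAtBottom`: every
parity gate of fan-in `≥ 2` reads inputs only; the guard `2 ≤ arity` is there because the gate
functions `⊕₀ = ∨₀` (constant `false`) and `⊕₁ = ∧₁ = ∨₁` (identity) coincide extensionally with AC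
gates, which must stay unconstrained).

* `ACdXORae d s` — `AC⁰-XOR` circuits of depth `≤ d` and size `≤ s n`, a.e.: gates over
  `acXorBasis = acBasis ∪ parityGates` (`¬`, `∧ₖ`, `∨ₖ`, `⊕ₖ` of every arity), parity gates at the
  bottom, `acDepth ≤ d` (negations do not count towards depth, a parity layer counts one), and
  `sizeWith acWeight ≤ s n` (every gate counts one EXCEPT negation gates, which are free). OURS ⊇
  PRINT'S at the same `s`, for every fixed depth convention up to the `∀ d` the facts quantify over:
  a printed AC⁰-XOR circuit with `s` gates (input literals free, negations only at the literals) maps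
  to a circuit here with the same AND/OR/XOR gates, a negated literal or negated parity costing one
  free `¬` gate; constants are eliminated by propagation (or the whole circuit is the single gate
  `∧₀`/`∨₀`), identity gates are spliced out. Conversely our circuits may be slightly more liberal
  (negations anywhere, free) — harmless on the HYPOTHESIS side of a magnification theorem, where the
  census needs OUR lower-bound statement to imply the printed one (our class ⊇ print's).
* `FORMULAXORae s` — `Formula-XOR[s]` = `U₂-Formula-⊕[s]`, a.e.: gates over `formulaXorBasis =
  deMorganBasis ∪ parityGates`, fan-out `≤ 1` (`IsFormula`), parity gates at the bottom, and
  `xorLeafCount ≤ s n`, where `Circuit.xorLeafCount` counts ONE per parity gate (a parity leaf,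
  whatever its arity — including `⊕₀`, a constant leaf, and `⊕₁`, a variable leaf) plus one per
  argument slot of a non-parity gate wired directly to an input variable (a literal leaf) plus one if
  the output wire is itself an input. OURS ⊇ PRINT'S at the same `s` exactly: literal `xᵢ` ↦ input
  wire; `¬xᵢ` ↦ a `¬` gate on an input wire (one slot); constant ↦ `⊕₀` (+ a `¬` above for `true`);
  parity leaf ↦ `⊕ₖ` on inputs (+ `¬` for a negated parity); internal `∧₂`/`∨₂`; leaf counts agree.
  (For KNOWN lower bounds one would need the converse containment; it holds too after splicing
  identity gates, but no K-side fact is stated over this class in the tree, so it is not proved.)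
  De Morgan formulas embed: `FORMULAae s ⊆ FORMULAXORae s` (`FORMULAae_subset_FORMULAXORae`; a De
  Morgan gate is never a parity gate, `not_mem_parityGates_of_mem_deMorganBasis`, so `xorLeafCount =
  leafSize` on De Morgan circuits).
* `AlmostFORMULAae γ s` — `γ-Almost-Formula[s]`, a.e.: De Morgan circuits (`∧₂`, `∨₂`, `¬`) with
  `size ≤ s n` gates of which at most `γ n` have fan-out `> 1` (`Circuit.refCount m`, the number of
  argument slots wired to gate `m`; being the output wire is not a use). OURS ⊇ PRINT'S whenever
  `2 ≤ s n`: printed almost-formulas may also use fan-in-`1` AND/OR gates and constants; identity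
  gates are spliced out and constants propagated without increasing the gate count or the number of
  gates of fan-out `> 1` (splicing `g = id(h)` moves `g`'s fan-out onto `h` and deletes `g`), the
  all-constant circuit becoming `x₀ ∧ ¬x₀`-type (2 gates, fan-out on an INPUT, which is free).
  `FORMULAae`-style formulas are the case `γ = 0` up to the size measure (gates here, leaves there).

Integer sizes make real size bounds exact under `⌊·⌋₊` (`k ≤ r ↔ k ≤ ⌊r⌋₊` for `k : ℕ`, `r ≥ 0`).

## Non-vacuity and monotonicity

`headLang ∈ ACdXORae d s` for all `d`, `s` (the projection `x₀`: no gates); `headLang ∈ FORMULAXORae s`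
as soon as `1 ≤ s n` eventually; `headLang ∈ AlmostFORMULAae γ s` for all `γ`, `s`; all three classes
are monotone in their parameters (eventual comparison suffices).
-/

noncomputable section

namespace Literature.Computability.MetaComplexity

open Literature.Computability.Complexity

/-! ### Parity gates and the two bases -/

/-- The parity gate functions `{⊕ₖ | k ∈ ℕ}` (CHOPRS 2020, §1.1 notes A/B: "arbitrary parity
functions", "an XOR of arbitrary arity"). [cite: arXiv191108297, §1.1 notes A and B (parity gates)] -/
def parityGates : Set GateFn := Set.range GateFn.xor

/-- The `Formula-XOR` basis: the De Morgan gates `∧₂`, `∨₂`, `¬` together with parity gates of every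
arity. [cite: arXiv191108297, §1.1 note B (Formula-XOR)] -/
def formulaXorBasis : Set GateFn := deMorganBasis ∪ parityGates

/-- The `AC⁰-XOR` basis: the unbounded fan-in AC basis together with parity gates of every arity.
[cite: arXiv191108297, §1.1 note A (AC⁰-XOR)] -/
def acXorBasis : Set GateFn := acBasis ∪ parityGates

/-- `⊕ₖ` is a parity gate. [folklore] -/
theorem xor_mem_parityGates (k : ℕ) : GateFn.xor k ∈ parityGates := ⟨k, rfl⟩

/-- `deMorganBasis ⊆ formulaXorBasis`. [folklore] -/
theorem deMorganBasis_subset_formulaXorBasis : deMorganBasis ⊆ formulaXorBasis :=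
  Set.subset_union_left

/-- `acBasis ⊆ acXorBasis`. [folklore] -/
theorem acBasis_subset_acXorBasis : acBasis ⊆ acXorBasis := Set.subset_union_left

/-- **A De Morgan gate is never a parity gate**: `∧₂ ≠ ⊕₂` and `∨₂ ≠ ⊕₂` (evaluate at `(1,1)`),
`¬ ≠ ⊕₁` (evaluate at `0`). Hence on De Morgan circuits the parity-leaf count below is the plain leaf
count. [folklore] -/
theorem not_mem_parityGates_of_mem_deMorganBasis {f : GateFn} (hf : f ∈ deMorganBasis) :
    f ∉ parityGates := by
  rintro ⟨k, hk⟩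
  simp only [deMorganBasis, Set.mem_insert_iff, Set.mem_singleton_iff] at hf
  rcases hf with rfl | rfl | rfl
  · have h1 : k = 2 := congrArg Sigma.fst hk
    subst h1
    have h2 := congrFun (eq_of_heq (Sigma.mk.inj_iff.1 hk).2) (fun _ => true)
    revert h2
    simp [GateFn.numOnes]
  · have h1 : k = 2 := congrArg Sigma.fst hk
    subst h1
    have h2 := congrFun (eq_of_heq (Sigma.mk.inj_iff.1 hk).2) (fun _ => true)
    revert h2
    simp [GateFn.numOnes]
  · have h1 : k = 1 := congrArg Sigma.fst hk
    subst h1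
    have h2 := congrFun (eq_of_heq (Sigma.mk.inj_iff.1 hk).2) (fun _ => false)
    revert h2
    simp [GateFn.numOnes]

/-! ### Parity gates at the bottom; the parity-leaf count -/

/-- **Parity gates sit at the bottom**: every parity gate of fan-in `≥ 2` of `C` reads input
variables only (CHOPRS 2020, note A: "gates at the bottom layer … compute arbitrary parity
functions"; note B: "each leaf is an XOR of arbitrary arity over the inputs"). The guard `2 ≤ arity`
leaves the degenerate gate functions `⊕₀ = ∨₀` and `⊕₁ = ∧₁ = ∨₁` unconstrained. Deliberate
dot-notation extension of `Complexity.Circuit`. [cite: arXiv191108297, §1.1 notes A and B (bottom parity layer)] -/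
def _root_.Literature.Computability.Complexity.Circuit.XorAtBottom {ι : Type*} (C : Circuit ι) :
    Prop :=
  ∀ g ∈ C.gates, g.fn ∈ parityGates → 2 ≤ g.arity → ∀ a, (g.args a).isLeft = true

open Classical in
/-- **The parity-leaf count** of a circuit: one for every parity gate (a parity leaf of any arity,
constants `⊕₀` and variables `⊕₁` included), plus one for every argument slot of a NON-parity gate
wired directly to an input variable (a literal leaf), plus one if the output wire is itself an input
variable. For a `Formula-XOR` / `U₂-Formula-⊕` tree this is the printed number of leaves (CHOPRS
2020 note B; OPS 2021 p. 4 "measured by the number of leaves"). [cite: arXiv191108297, §1.1 note B (leaves of Formula-XOR)] -/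
def _root_.Literature.Computability.Complexity.Circuit.xorLeafCount {ι : Type*} (C : Circuit ι) :
    ℕ :=
  (C.gates.map fun g =>
      if g.fn ∈ parityGates then 1 else (List.ofFn g.args).countP fun w => w.isLeft).sum +
    (if C.output.isLeft then 1 else 0)

/-- On a circuit without parity gates the parity-leaf count is the leaf size. [folklore] -/
theorem xorLeafCount_eq_leafSize {ι : Type*} {C : Circuit ι}
    (h : ∀ g ∈ C.gates, g.fn ∉ parityGates) : C.xorLeafCount = C.leafSize := by
  classical
  unfold Circuit.xorLeafCount Circuit.leafSize
  congr 1
  congr 1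
  exact List.map_congr_left fun g hg => by rw [if_neg (h g hg)]

/-- In particular on De Morgan circuits. [folklore] -/
theorem xorLeafCount_eq_leafSize_of_isOver_deMorgan {ι : Type*} {C : Circuit ι}
    (h : C.IsOver deMorganBasis) : C.xorLeafCount = C.leafSize :=
  xorLeafCount_eq_leafSize fun g hg => not_mem_parityGates_of_mem_deMorganBasis (h g hg)

/-- A circuit without parity gates has its (absent) parity gates at the bottom. [folklore] -/
theorem xorAtBottom_of_forall_not_mem {ι : Type*} {C : Circuit ι}
    (h : ∀ g ∈ C.gates, g.fn ∉ parityGates) : C.XorAtBottom :=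
  fun g hg hp => absurd hp (h g hg)

/-- The gate-free circuit `xᵢ` has parity-leaf count `1`. [folklore] -/
@[simp] theorem xorLeafCount_input {ι : Type*} (i : ι) :
    (Circuit.input i : Circuit ι).xorLeafCount = 1 := by
  simp [Circuit.xorLeafCount, Circuit.input]

/-- The gate-free circuit `xᵢ` has its parity gates at the bottom (it has none). [folklore] -/
theorem xorAtBottom_input {ι : Type*} (i : ι) : (Circuit.input i : Circuit ι).XorAtBottom :=
  fun g hg => by simp [Circuit.input] at hg

/-! ### The three almost-everywhere classes -/

/-- **`AC⁰_d-XOR[s]`, almost everywhere** (`ACdXORae d s`): languages decided by a circuit family over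
`acXorBasis` whose members, for all sufficiently large `n`, have their parity gates at the bottom,
`acDepth ≤ d` and at most `s n` non-negation gates (CHOPRS 2020, §1.1 note A; module docstring for
the containment of the printed class). [cite: arXiv191108297, §1.1 note A (AC⁰-XOR[s])] -/
def ACdXORae (d : ℕ) (s : ℕ → ℕ) : Set (Language Bool) :=
  FamilyAE fun n C => C.IsOver acXorBasis ∧ C.XorAtBottom ∧ C.acDepth ≤ d ∧ C.sizeWith acWeight ≤ s n

/-- **`Formula-XOR[s]` = `U₂-Formula-⊕[s]`, almost everywhere** (`FORMULAXORae s`): languages decided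
by a family of De-Morgan-plus-parity formulas (fan-out `≤ 1`, parity gates reading inputs only) of
parity-leaf count `≤ s n` for all sufficiently large `n` (CHOPRS 2020, §1.1 note B; OPS 2021, p. 4).
[cite: arXiv191108297, §1.1 note B (Formula-XOR[s])] -/
def FORMULAXORae (s : ℕ → ℕ) : Set (Language Bool) :=
  FamilyAE fun n C => C.IsOver formulaXorBasis ∧ C.IsFormula ∧ C.XorAtBottom ∧ C.xorLeafCount ≤ s n

/-- **`γ-Almost-Formula[s]`, almost everywhere** (`AlmostFORMULAae γ s`): languages decided by a
family of De Morgan circuits with at most `s n` gates of which at most `γ n` have fan-out larger than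
`1`, for all sufficiently large `n` (CHOPRS 2020, §1.1 note C). [cite: arXiv191108297, §1.1 note C (γ-Almost-Formula[s])] -/
def AlmostFORMULAae (γ s : ℕ → ℕ) : Set (Language Bool) :=
  FamilyAE fun n C => C.IsOver deMorganBasis ∧ C.size ≤ s n ∧
    ((Finset.range C.gates.length).filter fun m => 1 < C.refCount m).card ≤ γ n

/-! ### Monotonicity -/

/-- `ACdXORae` is monotone in depth and (eventual) size. [folklore] -/
theorem ACdXORae_mono {d d' : ℕ} (hd : d ≤ d') {s s' : ℕ → ℕ}
    (h : ∃ n₁ : ℕ, ∀ n ≥ n₁, s n ≤ s' n) : ACdXORae d s ⊆ ACdXORae d' s' := by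
  obtain ⟨n₁, hn₁⟩ := h
  exact FamilyAE_mono ⟨n₁, fun n hn C hC =>
    ⟨hC.1, hC.2.1, hC.2.2.1.trans hd, hC.2.2.2.trans (hn₁ n hn)⟩⟩

/-- `FORMULAXORae` is monotone in the (eventual) leaf bound. [folklore] -/
theorem FORMULAXORae_mono {s s' : ℕ → ℕ} (h : ∃ n₁ : ℕ, ∀ n ≥ n₁, s n ≤ s' n) :
    FORMULAXORae s ⊆ FORMULAXORae s' := by
  obtain ⟨n₁, hn₁⟩ := h
  exact FamilyAE_mono ⟨n₁, fun n hn C hC => ⟨hC.1, hC.2.1, hC.2.2.1, hC.2.2.2.trans (hn₁ n hn)⟩⟩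

/-- `AlmostFORMULAae` is monotone in both (eventual) bounds. [folklore] -/
theorem AlmostFORMULAae_mono {γ γ' s s' : ℕ → ℕ} (hγ : ∃ n₁ : ℕ, ∀ n ≥ n₁, γ n ≤ γ' n)
    (hs : ∃ n₁ : ℕ, ∀ n ≥ n₁, s n ≤ s' n) : AlmostFORMULAae γ s ⊆ AlmostFORMULAae γ' s' := by
  obtain ⟨n₁, hn₁⟩ := hγ
  obtain ⟨n₂, hn₂⟩ := hs
  exact FamilyAE_mono ⟨max n₁ n₂, fun n hn C hC =>
    ⟨hC.1, hC.2.1.trans (hn₂ n (le_of_max_le_right hn)),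
      hC.2.2.trans (hn₁ n (le_of_max_le_left hn))⟩⟩

/-- **De Morgan formulas are Formula-XOR formulas** with the same leaf bound. [folklore] -/
theorem FORMULAae_subset_FORMULAXORae (s : ℕ → ℕ) : FORMULAae s ⊆ FORMULAXORae s :=
  FamilyAE_mono ⟨0, fun n _ C hC =>
    ⟨fun g hg => deMorganBasis_subset_formulaXorBasis (hC.1 g hg), hC.2.1,
      xorAtBottom_of_forall_not_mem fun g hg => not_mem_parityGates_of_mem_deMorganBasis (hC.1 g hg),
      by rw [xorLeafCount_eq_leafSize_of_isOver_deMorgan hC.1]; exact hC.2.2⟩⟩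

/-! ### Non-vacuity -/

/-- **`ACdXORae d s` is inhabited for every `d` and `s`** (`headLang`: the projection `x₀`, no gates,
depth `0`, size `0`). [folklore] -/
theorem headLang_mem_ACdXORae (d : ℕ) (s : ℕ → ℕ) : headLang ∈ ACdXORae d s :=
  headLang_mem_FamilyAE ⟨0, fun n _ =>
    ⟨Circuit.isOver_input acXorBasis 0, xorAtBottom_input 0,
      by change (Circuit.input (0 : Fin (n + 1))).depthWith acWeight ≤ d
         simp [Circuit.depthWith, Circuit.input],
      by simp [Circuit.sizeWith, Circuit.input]⟩⟩

/-- **`FORMULAXORae s` is inhabited as soon as `1 ≤ s n` eventually** (`headLang`, one leaf).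
[folklore] -/
theorem headLang_mem_FORMULAXORae {s : ℕ → ℕ} (h : ∃ n₁ : ℕ, ∀ n ≥ n₁, 1 ≤ s n) :
    headLang ∈ FORMULAXORae s :=
  FORMULAae_subset_FORMULAXORae s (headLang_mem_FORMULAae h)

/-- **`AlmostFORMULAae γ s` is inhabited for every `γ` and `s`** (`headLang`: no gates). [folklore] -/
theorem headLang_mem_AlmostFORMULAae (γ s : ℕ → ℕ) : headLang ∈ AlmostFORMULAae γ s :=
  headLang_mem_FamilyAE ⟨0, fun n _ =>
    ⟨Circuit.isOver_input deMorganBasis 0, by simp [Circuit.size_input], by simp [Circuit.input]⟩⟩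

/-- Hence the promise problem lifted from `headLang` lies in every `promiseLift` of these classes
(with `1 ≤ s n` eventually for `FORMULAXORae`): lower-bound hypotheses over them are genuine.
[folklore] -/
theorem ofLanguage_headLang_mem_promiseLift_ACdXORae (d : ℕ) (s : ℕ → ℕ) :
    PromiseProblem.ofLanguage headLang ∈ promiseLift (ACdXORae d s) :=
  ofLanguage_mem_promiseLift_iff.2 (headLang_mem_ACdXORae d s)

end Literature.Computability.MetaComplexity
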